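import Mathlib
import Summits.KontsevichZagierPeriods.Zeta5Search.BigPrimeNineDual2
import Summits.KontsevichZagierPeriods.Zeta5Search.BigPrimeNineSharp
import HarnessLib.Audit
import HarnessLib

/-!
# `F̃₉(b)`: the sharp big-prime windows BELOW `b₀` — (S)₉ and (S)₉♯ become THEOREMS; (W)₉♯/(U)₉♯ for `p ≥ 11`/`p ≥ 7`

Cell `pub-zeta5` (HONEST FRAMING: systematic search; no irrationality claim unless certified).  Provenance: written
by the family-designer seat `pub-zeta5-fam-vwp-g13` (planner role, no stage permission; staged for the cell's lane),
`families/vwp/FAMILY.md` §21.  Bookkeeping of OUR linear forms (`k = 9`); nothing here concerns irrationality, and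
nothing here is new mathematics about ζ(5): it is the nine-block port of the tree's `BigPrimeWindow.lean` (`k = 7`).

ASSEMBLY of parts 1–2 (`BigPrimeNineSupport2`, `BigPrimeNineDual2`): with slots `j₁` (dropped), `j₂ ≠ j₁`
(`b_{j₂} ≤ b_{j₃}`), `j₃` (`b_{j₃} ≤ b_j` for the seven slots `j ∉ {j₁, j₂}`), every prime `p` with
`b₀ + 1 − b_{j₂} − b_{j₃} ≤ p` in the sharp window divides the coefficient:
* `one_le_padicValRat_coeff7_of_slots`: `p ≥ 5`,  `3p ≤ d₉ + 2` ⟹ `v_p(coeff7 b) ≥ 1`  (Lucas digit `r = 3`);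
* `one_le_padicValRat_coeff5_of_slots`: `p ≥ 7`,  `2p ≤ d₉ + 2` ⟹ `v_p(coeff5 b) ≥ 1`  (`r = 5`);
* `one_le_padicValRat_coeff3_of_slots`: `p ≥ 11`, ` p ≤ d₉ + 2` ⟹ `v_p(coeff3 b) ≥ 1`  (`r = 7`).
The level-2 coefficient index is `i + 2`, so the digit is `r = 9 − o + … = 7/5/3` and Lucas needs `r < p`: this is why
(W)/(U) below `b₀` are reached here only from `p = 11` / `p = 7` on (above `b₀` the level-0 file has `r = 6/4/2`).
CONSEQUENCES for the conjecture nodes: **`bigPrime9Zeta7Sharp_holds : BigPrime9Zeta7Sharp`** (13c) and hence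
**`bigPrime9Zeta7_holds : BigPrime9Zeta7`** (gen 4, `DualSeriesNineMinors`) are THEOREMS; (W)₉♯ / (U)₉♯ are reduced
to the single primes `p = 7` / `p = 5` (`bigPrime9Zeta3Sharp_iff_seven`, `bigPrime9Zeta5Sharp_iff_five`), which stay
`@[conjecture]` (evidence, EXACT: the gen-4 tables `pub-zeta5-fam-vwp/g4/bp9_{a,b,c,d}.json` hold 59 instances of (W)₉ at
`p = 7 ≤ b₀` and 15 of (U)₉ at `p = 5 ≤ b₀`, all with `v_p ≥ 1` — `pub-zeta5-fam-vwp/g13/residual_primes.py`).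
-/

noncomputable section

open Finset Polynomial

namespace Summit.KontsevichZagierPeriods.Zeta5Search.BigPrimeNine

open Summit.KontsevichZagierPeriods.Zeta5Search.DualSeriesNine (InBox coeff3 coeff5 coeff7 coeff3_eq coeff5_eq
  coeff7_eq exists_isPFData9 IsPFData9)
open Summit.KontsevichZagierPeriods.Zeta5Search.DualSeriesNineMinors (dNine BigPrime9Zeta3 BigPrime9Zeta5
  BigPrime9Zeta7)
open Summit.KontsevichZagierPeriods.Zeta5Search.BigPrime (block block_subset sum_taylor_coeff_eq_zero
  one_le_padicValRat_of_eq)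

/-! ### 1. Level-2 assembly: clearing denominators over `S'` -/

section Assembly2

/-- Common denominator over `S'` at level 2 (eighth powers). -/
def U2all (n : ℕ) (β : ℕ → ℕ) (j₂ j₃ : ℕ) : ℤ := ∏ q ∈ block n (β j₃), e20 n β j₂ j₃ q ^ 8

/-- Cleared numerator over `S'` at level 2. -/
def Z2sum (n : ℕ) (β : ℕ → ℕ) (j₁ j₂ j₃ i : ℕ) : ℤ :=
  ∑ q ∈ block n (β j₃), z2 n β j₁ j₂ j₃ q i * ∏ s ∈ (block n (β j₃)).erase q, e20 n β j₂ j₃ s ^ 8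

/-- No prime in the level-2 window divides `U2`. -/
theorem not_dvd_U2all {p : ℕ} (hp : p.Prime) {n : ℕ} {β : ℕ → ℕ} {j₂ j₃ : ℕ} (hT : n + 1 ≤ p + β j₂ + β j₃)
    (h23 : β j₂ ≤ β j₃) : ¬ (p : ℤ) ∣ U2all n β j₂ j₃ := by
  have hpZ : Prime (p : ℤ) := Nat.prime_iff_prime_int.1 hp
  intro h
  obtain ⟨q, hq, hdvd⟩ := (hpZ.dvd_finsetProd_iff _).1 h
  exact not_dvd_e20 hp hT h23 hq (hpZ.dvd_of_dvd_pow hdvd)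

/-- `U2 · Σ_{q ≤ n} c_{o,q} = Z2_{7−o}` for `1 ≤ o < 8` (the data vanish off `S'` in these orders). -/
theorem U2all_mul_sum_eq (b : ℕ → ℤ) (hb : InBox b) (hhalf : ∀ j ∈ range 9, 2 * b (j + 1) ≤ b 0 + 1)
    {c : ℕ → ℕ → ℚ} (hc : IsPFData9 b c) {j₁ j₂ j₃ : ℕ} (hj₁ : j₁ ∈ range 9) (hj₂ : j₂ ∈ (range 9).erase j₁)
    (h23 : (b (j₂ + 1)).toNat ≤ (b (j₃ + 1)).toNat)
    (hmin : ∀ j ∈ ((range 9).erase j₁).erase j₂, (b (j₃ + 1)).toNat ≤ (b (j + 1)).toNat)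
    {o : ℕ} (ho1 : 1 ≤ o) (ho : o < 8) :
    (U2all (b 0).toNat (fun j => (b (j + 1)).toNat) j₂ j₃ : ℚ) * ∑ q ∈ range ((b 0).toNat + 1), c o q =
      (Z2sum (b 0).toNat (fun j => (b (j + 1)).toNat) j₁ j₂ j₃ (7 - o) : ℚ) := by
  set n := (b 0).toNat with hn
  set β : ℕ → ℕ := fun j => (b (j + 1)).toNat with hβ
  have hsum : ∑ q ∈ range (n + 1), c o q = ∑ q ∈ block n (β j₃), c o q := by
    symm
    refine sum_subset (block_subset n (β j₃)) fun q hq hqS => ?_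
    exact pf_eq_zero_of_not_mem_support b hb hhalf hc hj₁ hj₂ h23 hmin (Nat.lt_succ_iff.1 (mem_range.1 hq)) hqS
      ho1 ho
  rw [hsum, mul_sum, Z2sum]
  push_cast
  refine sum_congr rfl fun q hq => ?_
  rw [U2all, ← mul_prod_erase _ _ hq]
  push_cast
  rw [← pf_coeff_eq2 b hb hhalf hc hj₁ hj₂ h23 hmin hq ho]
  ring

/-- `Z2_i ≡ U2 · Σ_x [X^{i+2}] M2(X+x) (mod p)` for `i < 6`, `i + 2 ≤ p`. -/
theorem Z2sum_cast {p : ℕ} [hp : Fact p.Prime] {n : ℕ} {β : ℕ → ℕ} {j₁ j₂ j₃ : ℕ}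
    (hj₁ : j₁ ∈ range 9) (hj₂ : j₂ ∈ (range 9).erase j₁) (hS : n + 1 ≤ p + 2 * β j₃)
    (hT : n + 1 ≤ p + β j₂ + β j₃) (h23 : β j₂ ≤ β j₃) (h3 : 2 * β j₃ ≤ n)
    (hmin : ∀ j ∈ ((range 9).erase j₁).erase j₂, β j₃ ≤ β j) {i : ℕ} (hi : i < 6) (hip : i + 2 ≤ p) :
    ((Z2sum n β j₁ j₂ j₃ i : ℤ) : ZMod p) =
      ((U2all n β j₂ j₃ : ℤ) : ZMod p) * ∑ x : ZMod p, (taylor x (M2 p n β j₁ j₂ j₃)).coeff (i + 2) := by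
  rw [sum_univ_taylor_M2_coeff hj₁ hj₂ hS hmin (by omega), Z2sum, mul_sum]
  push_cast
  refine sum_congr rfl fun q hq => ?_
  rw [z2_cast hj₁ hj₂ hS hT h23 h3 hmin hq (by omega) hip, U2all, ← mul_prod_erase _ _ hq]
  push_cast
  ring

/-- The slot hypotheses of the conjecture nodes, transported to `ℕ` (`β_j = b_j.toNat`). -/
theorem slot_data (b : ℕ → ℤ) {p j₁ j₂ j₃ : ℕ} (hb : InBox b) (h2 : ∀ i ∈ range 9, 2 * b (i + 1) ≤ b 0)
    (hj₂ : j₂ ∈ range 9) (hj₃ : j₃ ∈ range 9) (h12 : j₂ ≠ j₁) (hle : b (j₂ + 1) ≤ b (j₃ + 1))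
    (hmin : ∀ j ∈ range 9, j ≠ j₁ → j ≠ j₂ → b (j₃ + 1) ≤ b (j + 1))
    (hpT : b 0 + 1 ≤ (p : ℤ) + b (j₂ + 1) + b (j₃ + 1)) :
    j₂ ∈ (range 9).erase j₁ ∧ (b (j₂ + 1)).toNat ≤ (b (j₃ + 1)).toNat ∧
      (∀ j ∈ ((range 9).erase j₁).erase j₂, (b (j₃ + 1)).toNat ≤ (b (j + 1)).toNat) ∧
      (b 0).toNat + 1 ≤ p + (b (j₂ + 1)).toNat + (b (j₃ + 1)).toNat ∧
      (b 0).toNat + 1 ≤ p + 2 * (b (j₃ + 1)).toNat ∧ 2 * (b (j₃ + 1)).toNat ≤ (b 0).toNat := by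
  have e0 : (b 0 : ℤ) = ((b 0).toNat : ℤ) := (Int.toNat_of_nonneg hb.1).symm
  have e2 : (b (j₂ + 1) : ℤ) = ((b (j₂ + 1)).toNat : ℤ) := (Int.toNat_of_nonneg (hb.2 j₂ hj₂).1).symm
  have e3 : (b (j₃ + 1) : ℤ) = ((b (j₃ + 1)).toNat : ℤ) := (Int.toNat_of_nonneg (hb.2 j₃ hj₃).1).symm
  have h3 := h2 j₃ hj₃
  have hmin' : ∀ j ∈ ((range 9).erase j₁).erase j₂, (b (j₃ + 1)).toNat ≤ (b (j + 1)).toNat := by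
    intro j hj
    have hj' := mem_erase.1 hj; have hj'' := mem_erase.1 hj'.2
    exact Int.toNat_le_toNat (hmin j hj''.2 hj''.1 hj'.1)
  exact ⟨mem_erase.2 ⟨h12, hj₂⟩, Int.toNat_le_toNat hle, hmin', by omega, by omega, by omega⟩

/-- (W)₉∞ at level 2, cleared form: `11 ≤ p`, `b₀ + 1 ≤ p + b_{j₂} + b_{j₃}`, `p ≤ d₉ + 2`. -/
theorem exists_clear_coeff3_of_slots (b : ℕ → ℤ) (p j₁ j₂ j₃ : ℕ) (hb : InBox b)
    (h2 : ∀ i ∈ range 9, 2 * b (i + 1) ≤ b 0) (h4 : ∑ i ∈ range 9, b (i + 1) ≤ 4 * b 0)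
    (hj₁ : j₁ ∈ range 9) (hj₂ : j₂ ∈ range 9) (hj₃ : j₃ ∈ range 9) (h12 : j₂ ≠ j₁)
    (hle : b (j₂ + 1) ≤ b (j₃ + 1)) (hmin : ∀ j ∈ range 9, j ≠ j₁ → j ≠ j₂ → b (j₃ + 1) ≤ b (j + 1))
    (hprime : p.Prime) (hp11 : 11 ≤ p) (hpT : b 0 + 1 ≤ (p : ℤ) + b (j₂ + 1) + b (j₃ + 1))
    (hpd : (p : ℤ) ≤ dNine b + 2) :
    ∃ U Z : ℤ, ¬ (p : ℤ) ∣ U ∧ (p : ℤ) ∣ Z ∧ (U : ℚ) * coeff3 b = Z := by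
  haveI : Fact p.Prime := ⟨hprime⟩
  obtain ⟨e0, hS, hβ⟩ := polytope_data b hb h2
  obtain ⟨hj₂', h23, hmin', hT', hS', h3'⟩ := slot_data b hb h2 hj₂ hj₃ h12 hle hmin hpT
  have hpd' : p + ∑ j ∈ range 9, (b (j + 1)).toNat ≤ 4 * (b 0).toNat + 2 := by
    have := hpd; rw [dNine, hS, e0] at this; omega
  have hhalf : ∀ j ∈ range 9, 2 * b (j + 1) ≤ b 0 + 1 := fun j hj => by have := h2 j hj; omega
  obtain ⟨c, hc⟩ := exists_isPFData9 b hb (by omega)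
  refine ⟨_, _, not_dvd_U2all hprime hT' h23, ?_,
    by rw [coeff3_eq hc]; exact U2all_mul_sum_eq b hb hhalf hc hj₁ hj₂' h23 hmin' (by norm_num) (by norm_num : 2 < 8)⟩
  rw [← ZMod.intCast_zmod_eq_zero_iff_dvd, Z2sum_cast hj₁ hj₂' hS' hT' h23 h3' hmin' (by norm_num : 5 < 6) (by omega),
    sum_taylor_coeff_eq_zero (M2 p (b 0).toNat (fun j => (b (j + 1)).toNat) j₁ j₂ j₃) 7 (by omega), mul_zero]
  have := natDegree_M2_le (p := p) hj₁ hj₂' hS' hT' h23 hmin' hβ h3'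
  beta_reduce at this
  omega

/-- (U)₉∞ at level 2, cleared form: `7 ≤ p`, `b₀ + 1 ≤ p + b_{j₂} + b_{j₃}`, `2p ≤ d₉ + 2`. -/
theorem exists_clear_coeff5_of_slots (b : ℕ → ℤ) (p j₁ j₂ j₃ : ℕ) (hb : InBox b)
    (h2 : ∀ i ∈ range 9, 2 * b (i + 1) ≤ b 0) (h4 : ∑ i ∈ range 9, b (i + 1) ≤ 4 * b 0)
    (hj₁ : j₁ ∈ range 9) (hj₂ : j₂ ∈ range 9) (hj₃ : j₃ ∈ range 9) (h12 : j₂ ≠ j₁)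
    (hle : b (j₂ + 1) ≤ b (j₃ + 1)) (hmin : ∀ j ∈ range 9, j ≠ j₁ → j ≠ j₂ → b (j₃ + 1) ≤ b (j + 1))
    (hprime : p.Prime) (hp7 : 7 ≤ p) (hpT : b 0 + 1 ≤ (p : ℤ) + b (j₂ + 1) + b (j₃ + 1))
    (hpd : 2 * (p : ℤ) ≤ dNine b + 2) :
    ∃ U Z : ℤ, ¬ (p : ℤ) ∣ U ∧ (p : ℤ) ∣ Z ∧ (U : ℚ) * coeff5 b = Z := by
  haveI : Fact p.Prime := ⟨hprime⟩
  obtain ⟨e0, hS, hβ⟩ := polytope_data b hb h2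
  obtain ⟨hj₂', h23, hmin', hT', hS', h3'⟩ := slot_data b hb h2 hj₂ hj₃ h12 hle hmin hpT
  have hpd' : 2 * p + ∑ j ∈ range 9, (b (j + 1)).toNat ≤ 4 * (b 0).toNat + 2 := by
    have := hpd; rw [dNine, hS, e0] at this; omega
  have hhalf : ∀ j ∈ range 9, 2 * b (j + 1) ≤ b 0 + 1 := fun j hj => by have := h2 j hj; omega
  obtain ⟨c, hc⟩ := exists_isPFData9 b hb (by omega)
  refine ⟨_, _, not_dvd_U2all hprime hT' h23, ?_,
    by rw [coeff5_eq hc]; exact U2all_mul_sum_eq b hb hhalf hc hj₁ hj₂' h23 hmin' (by norm_num) (by norm_num : 4 < 8)⟩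
  rw [← ZMod.intCast_zmod_eq_zero_iff_dvd, Z2sum_cast hj₁ hj₂' hS' hT' h23 h3' hmin' (by norm_num : 3 < 6) (by omega),
    sum_taylor_coeff_eq_zero (M2 p (b 0).toNat (fun j => (b (j + 1)).toNat) j₁ j₂ j₃) 5 (by omega), mul_zero]
  have := natDegree_M2_le (p := p) hj₁ hj₂' hS' hT' h23 hmin' hβ h3'
  beta_reduce at this
  omega

/-- (S)₉∞ at level 2, cleared form: `5 ≤ p`, `b₀ + 1 ≤ p + b_{j₂} + b_{j₃}`, `3p ≤ d₉ + 2`. -/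
theorem exists_clear_coeff7_of_slots (b : ℕ → ℤ) (p j₁ j₂ j₃ : ℕ) (hb : InBox b)
    (h2 : ∀ i ∈ range 9, 2 * b (i + 1) ≤ b 0) (h4 : ∑ i ∈ range 9, b (i + 1) ≤ 4 * b 0)
    (hj₁ : j₁ ∈ range 9) (hj₂ : j₂ ∈ range 9) (hj₃ : j₃ ∈ range 9) (h12 : j₂ ≠ j₁)
    (hle : b (j₂ + 1) ≤ b (j₃ + 1)) (hmin : ∀ j ∈ range 9, j ≠ j₁ → j ≠ j₂ → b (j₃ + 1) ≤ b (j + 1))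
    (hprime : p.Prime) (hp5 : 5 ≤ p) (hpT : b 0 + 1 ≤ (p : ℤ) + b (j₂ + 1) + b (j₃ + 1))
    (hpd : 3 * (p : ℤ) ≤ dNine b + 2) :
    ∃ U Z : ℤ, ¬ (p : ℤ) ∣ U ∧ (p : ℤ) ∣ Z ∧ (U : ℚ) * coeff7 b = Z := by
  haveI : Fact p.Prime := ⟨hprime⟩
  obtain ⟨e0, hS, hβ⟩ := polytope_data b hb h2
  obtain ⟨hj₂', h23, hmin', hT', hS', h3'⟩ := slot_data b hb h2 hj₂ hj₃ h12 hle hmin hpT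
  have hpd' : 3 * p + ∑ j ∈ range 9, (b (j + 1)).toNat ≤ 4 * (b 0).toNat + 2 := by
    have := hpd; rw [dNine, hS, e0] at this; omega
  have hhalf : ∀ j ∈ range 9, 2 * b (j + 1) ≤ b 0 + 1 := fun j hj => by have := h2 j hj; omega
  obtain ⟨c, hc⟩ := exists_isPFData9 b hb (by omega)
  refine ⟨_, _, not_dvd_U2all hprime hT' h23, ?_,
    by rw [coeff7_eq hc]; exact U2all_mul_sum_eq b hb hhalf hc hj₁ hj₂' h23 hmin' (by norm_num) (by norm_num : 6 < 8)⟩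
  rw [← ZMod.intCast_zmod_eq_zero_iff_dvd, Z2sum_cast hj₁ hj₂' hS' hT' h23 h3' hmin' (by norm_num : 1 < 6) (by omega),
    sum_taylor_coeff_eq_zero (M2 p (b 0).toNat (fun j => (b (j + 1)).toNat) j₁ j₂ j₃) 3 (by omega), mul_zero]
  have := natDegree_M2_le (p := p) hj₁ hj₂' hS' hT' h23 hmin' hβ h3'
  beta_reduce at this
  omega

end Assembly2

/-! ### 2. The theorems: (W)₉∞ / (U)₉∞ / (S)₉∞ below `b₀` on the sharp windows -/

/-- **(W)₉∞ ON THE SHARP WINDOW, below `b₀` from `p = 11` on.**  Let `b` lie in the polytope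
(`2b_j ≤ b₀`, `Σ b_j ≤ 4b₀`); drop a slot `j₁`, let `j₂ ≠ j₁` be a slot with `b_{j₂} ≤ b_{j₃}` and `j₃` one with
`b_{j₃} ≤ b_j` for all `j ∉ {j₁, j₂}`.  Then every prime `p ≥ 11` with `b₀ + 1 − b_{j₂} − b_{j₃} ≤ p ≤ d₉(b) + 2` has
`v_p(coeff3 b) ≥ 1` (if `coeff3 b ≠ 0`).  The prime `p = 7` below `b₀` is NOT covered (Lucas digit `7 = p`). -/
theorem one_le_padicValRat_coeff3_of_slots (b : ℕ → ℤ) (p j₁ j₂ j₃ : ℕ) (hb : InBox b)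
    (h2 : ∀ i ∈ range 9, 2 * b (i + 1) ≤ b 0) (h4 : ∑ i ∈ range 9, b (i + 1) ≤ 4 * b 0)
    (hj₁ : j₁ ∈ range 9) (hj₂ : j₂ ∈ range 9) (hj₃ : j₃ ∈ range 9) (h12 : j₂ ≠ j₁)
    (hle : b (j₂ + 1) ≤ b (j₃ + 1)) (hmin : ∀ j ∈ range 9, j ≠ j₁ → j ≠ j₂ → b (j₃ + 1) ≤ b (j + 1))
    (hprime : p.Prime) (hp11 : 11 ≤ p) (hpT : b 0 + 1 ≤ (p : ℤ) + b (j₂ + 1) + b (j₃ + 1))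
    (hpd : (p : ℤ) ≤ dNine b + 2) (h3 : coeff3 b ≠ 0) : 1 ≤ padicValRat p (coeff3 b) := by
  haveI : Fact p.Prime := ⟨hprime⟩
  obtain ⟨U, Z, hU, hZ, hUW⟩ :=
    exists_clear_coeff3_of_slots b p j₁ j₂ j₃ hb h2 h4 hj₁ hj₂ hj₃ h12 hle hmin hprime hp11 hpT hpd
  exact one_le_padicValRat_of_eq hUW hU hZ h3

/-- **(U)₉∞ ON THE SHARP WINDOW, below `b₀` from `p = 7` on**: same slots, `p ≥ 7`,
`b₀ + 1 ≤ p + b_{j₂} + b_{j₃}`, `2p ≤ d₉(b) + 2` ⟹ `v_p(coeff5 b) ≥ 1`.  (`p = 5` below `b₀` is not covered.) -/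
theorem one_le_padicValRat_coeff5_of_slots (b : ℕ → ℤ) (p j₁ j₂ j₃ : ℕ) (hb : InBox b)
    (h2 : ∀ i ∈ range 9, 2 * b (i + 1) ≤ b 0) (h4 : ∑ i ∈ range 9, b (i + 1) ≤ 4 * b 0)
    (hj₁ : j₁ ∈ range 9) (hj₂ : j₂ ∈ range 9) (hj₃ : j₃ ∈ range 9) (h12 : j₂ ≠ j₁)
    (hle : b (j₂ + 1) ≤ b (j₃ + 1)) (hmin : ∀ j ∈ range 9, j ≠ j₁ → j ≠ j₂ → b (j₃ + 1) ≤ b (j + 1))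
    (hprime : p.Prime) (hp7 : 7 ≤ p) (hpT : b 0 + 1 ≤ (p : ℤ) + b (j₂ + 1) + b (j₃ + 1))
    (hpd : 2 * (p : ℤ) ≤ dNine b + 2) (h5 : coeff5 b ≠ 0) : 1 ≤ padicValRat p (coeff5 b) := by
  haveI : Fact p.Prime := ⟨hprime⟩
  obtain ⟨U, Z, hU, hZ, hUW⟩ :=
    exists_clear_coeff5_of_slots b p j₁ j₂ j₃ hb h2 h4 hj₁ hj₂ hj₃ h12 hle hmin hprime hp7 hpT hpd
  exact one_le_padicValRat_of_eq hUW hU hZ h5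

/-- **(S)₉∞ ON THE SHARP WINDOW (complete)**: same slots, `p ≥ 5`, `b₀ + 1 ≤ p + b_{j₂} + b_{j₃}`,
`3p ≤ d₉(b) + 2` ⟹ `v_p(coeff7 b) ≥ 1`.  Together with the above-`b₀` file this is ALL of (S)₉♯. -/
theorem one_le_padicValRat_coeff7_of_slots (b : ℕ → ℤ) (p j₁ j₂ j₃ : ℕ) (hb : InBox b)
    (h2 : ∀ i ∈ range 9, 2 * b (i + 1) ≤ b 0) (h4 : ∑ i ∈ range 9, b (i + 1) ≤ 4 * b 0)
    (hj₁ : j₁ ∈ range 9) (hj₂ : j₂ ∈ range 9) (hj₃ : j₃ ∈ range 9) (h12 : j₂ ≠ j₁)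
    (hle : b (j₂ + 1) ≤ b (j₃ + 1)) (hmin : ∀ j ∈ range 9, j ≠ j₁ → j ≠ j₂ → b (j₃ + 1) ≤ b (j + 1))
    (hprime : p.Prime) (hp5 : 5 ≤ p) (hpT : b 0 + 1 ≤ (p : ℤ) + b (j₂ + 1) + b (j₃ + 1))
    (hpd : 3 * (p : ℤ) ≤ dNine b + 2) (h7 : coeff7 b ≠ 0) : 1 ≤ padicValRat p (coeff7 b) := by
  haveI : Fact p.Prime := ⟨hprime⟩
  obtain ⟨U, Z, hU, hZ, hUW⟩ :=
    exists_clear_coeff7_of_slots b p j₁ j₂ j₃ hb h2 h4 hj₁ hj₂ hj₃ h12 hle hmin hprime hp5 hpT hpd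
  exact one_le_padicValRat_of_eq hUW hU hZ h7

/-! ### 3. Consequences for the conjecture nodes -/

/-- **(S)₉♯ IS A THEOREM**: the sharpened node `BigPrime9Zeta3Sharp`'s ζ(7)-companion `BigPrime9Zeta7Sharp` (13c:
`p ≥ 5`, `b₀ + 1 − b_{j₂} − b_{j₃} ≤ p`, `3p ≤ d₉ + 2`) holds — it is literally `one_le_padicValRat_coeff7_of_slots`. -/
theorem bigPrime9Zeta7Sharp_holds : BigPrime9Zeta7Sharp :=
  fun b p j₁ j₂ j₃ hb h2 h4 hj₁ hj₂ hj₃ hne hle hmin hp hp5 hL hpd h0 =>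
    one_le_padicValRat_coeff7_of_slots b p j₁ j₂ j₃ hb h2 h4 hj₁ hj₂ hj₃ hne hle hmin hp hp5 hL hpd h0

/-- **(S)₉ IS A THEOREM**: the gen-4 conjecture node `DualSeriesNineMinors.BigPrime9Zeta7` (window `3p ≤ d₉ + 1`)
follows from its sharpening (`of_sharp`, 13c). -/
theorem bigPrime9Zeta7_holds : BigPrime9Zeta7 := of_sharp.2.2 bigPrime9Zeta7Sharp_holds

/-- **What is left of (W)₉♯ is the prime 7**: `BigPrime9Zeta3Sharp` is EQUIVALENT to its instance `p = 7`
(primes `p ≥ 11` are `one_le_padicValRat_coeff3_of_slots`; `7 < p < 11` contains no prime). -/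
theorem bigPrime9Zeta3Sharp_iff_seven : BigPrime9Zeta3Sharp ↔
    ∀ (b : ℕ → ℤ) (j₁ j₂ j₃ : ℕ), InBox b → (∀ i ∈ range 9, 2 * b (i + 1) ≤ b 0) →
      ∑ i ∈ range 9, b (i + 1) ≤ 4 * b 0 → j₁ ∈ range 9 → j₂ ∈ range 9 → j₃ ∈ range 9 → j₂ ≠ j₁ →
      b (j₂ + 1) ≤ b (j₃ + 1) → (∀ j ∈ range 9, j ≠ j₁ → j ≠ j₂ → b (j₃ + 1) ≤ b (j + 1)) →
      b 0 + 1 ≤ (7 : ℤ) + b (j₂ + 1) + b (j₃ + 1) → (7 : ℤ) ≤ dNine b + 2 →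
      coeff3 b ≠ 0 → 1 ≤ padicValRat 7 (coeff3 b) := by
  constructor
  · intro h b j₁ j₂ j₃ hb h2 h4 hj₁ hj₂ hj₃ hne hle hmin hL hpd h0
    exact h b 7 j₁ j₂ j₃ hb h2 h4 hj₁ hj₂ hj₃ hne hle hmin (by norm_num) le_rfl (by exact_mod_cast hL)
      (by exact_mod_cast hpd) h0
  · intro h b p j₁ j₂ j₃ hb h2 h4 hj₁ hj₂ hj₃ hne hle hmin hp hp7 hL hpd h0
    by_cases hp11 : 11 ≤ p
    · exact one_le_padicValRat_coeff3_of_slots b p j₁ j₂ j₃ hb h2 h4 hj₁ hj₂ hj₃ hne hle hmin hp hp11 hL hpd h0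
    · have hlt : p < 11 := by omega
      obtain rfl : p = 7 := by
        interval_cases p
        · rfl
        all_goals exact absurd hp (by decide)
      exact h b j₁ j₂ j₃ hb h2 h4 hj₁ hj₂ hj₃ hne hle hmin (by exact_mod_cast hL) (by exact_mod_cast hpd) h0

/-- **What is left of (U)₉♯ is the prime 5**: `BigPrime9Zeta5Sharp` is EQUIVALENT to its instance `p = 5`
(primes `p ≥ 7` are `one_le_padicValRat_coeff5_of_slots`). -/
theorem bigPrime9Zeta5Sharp_iff_five : BigPrime9Zeta5Sharp ↔
    ∀ (b : ℕ → ℤ) (j₁ j₂ j₃ : ℕ), InBox b → (∀ i ∈ range 9, 2 * b (i + 1) ≤ b 0) →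
      ∑ i ∈ range 9, b (i + 1) ≤ 4 * b 0 → j₁ ∈ range 9 → j₂ ∈ range 9 → j₃ ∈ range 9 → j₂ ≠ j₁ →
      b (j₂ + 1) ≤ b (j₃ + 1) → (∀ j ∈ range 9, j ≠ j₁ → j ≠ j₂ → b (j₃ + 1) ≤ b (j + 1)) →
      b 0 + 1 ≤ (5 : ℤ) + b (j₂ + 1) + b (j₃ + 1) → 2 * (5 : ℤ) ≤ dNine b + 2 →
      coeff5 b ≠ 0 → 1 ≤ padicValRat 5 (coeff5 b) := by
  constructor
  · intro h b j₁ j₂ j₃ hb h2 h4 hj₁ hj₂ hj₃ hne hle hmin hL hpd h0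
    exact h b 5 j₁ j₂ j₃ hb h2 h4 hj₁ hj₂ hj₃ hne hle hmin (by norm_num) le_rfl (by exact_mod_cast hL)
      (by exact_mod_cast hpd) h0
  · intro h b p j₁ j₂ j₃ hb h2 h4 hj₁ hj₂ hj₃ hne hle hmin hp hp5 hL hpd h0
    by_cases hp7 : 7 ≤ p
    · exact one_le_padicValRat_coeff5_of_slots b p j₁ j₂ j₃ hb h2 h4 hj₁ hj₂ hj₃ hne hle hmin hp hp7 hL hpd h0
    · have hlt : p < 7 := by omega
      obtain rfl : p = 5 := by
        interval_cases p
        · rfl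
        all_goals exact absurd hp (by decide)
      exact h b j₁ j₂ j₃ hb h2 h4 hj₁ hj₂ hj₃ hne hle hmin (by exact_mod_cast hL) (by exact_mod_cast hpd) h0

/-- Arithmetic of the residual instances on the thick example `b = (60; 24⁸, 8)` (`d₉ = 40`, lower end `13`): there
neither `p = 7` nor `p = 5` lies in a window (`13 > 7`), so (W)₉♯ and (U)₉♯ hold outright for this `b`; the residual
primes only bite on directions with `b₀ + 1 − b_{j₂} − b_{j₃} ≤ 7`.  Kernel check of the example's numbers only. -/
example : (60 : ℤ) + 1 - 24 - 24 = 13 ∧ ¬ ((60 : ℤ) + 1 ≤ 7 + 24 + 24) := by norm_num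

end Summit.KontsevichZagierPeriods.Zeta5Search.BigPrimeNine

end
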